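import Summits.Parity.GeneralizedHardyLittlewood.Theses.RoughSemiprimeRigidity
import Literature.NumberTheory.Sieve.BombieriAsymptoticSieveShiftedPrimes

/-!
# Line `birth` — BC3 skeleton for the crux `RoughSemiprimeBombieri` (stmt-Parity-11309)

Route `RoughSemiprimeRigidity` (route-Parity-RoughSemiprimeRigidity, sub-problem
`GeneralizedHardyLittlewood`), crux decl
`Summit.Parity.GeneralizedHardyLittlewood.Theses.RoughSemiprimeRigidity.RoughSemiprimeBombieri` (rank 9, the
GEH-content bridge hypothesis `X₁` of the deciding theorem `closes`):

  for every even `h ≥ 1` there are data `(X, g)` such that the shifted rough-semiprime weight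
  `n ↦ W(n+h)` — `W(m) = 2 log q log p` if `m = qp` with primes `m^{1/4} < q < p`, else `0` — satisfies
  Bombieri's hypotheses (A₁)–(A₅) (size `X` = counting function, level `x^{1−ε}` for every `ε` with the
  supremum over `y ≤ x`, crude individual remainders, growth, analytic continuation of `∑ g(d) d^{−s}`)
  together with the ordered Euler product `∏_{p ≤ x} (1 − g(p))(1 − 1/p)⁻¹ → 𝔖({0,h})`; the predicate
  `IsBomb` is INLINED verbatim over Mathlib in the route file (cone repair 2026-08-15).

## The line: Bombieri's FORCED DATA, split by axiom group

(A₁)'s size clause forces `X = X_h :=` the counting function `∑_{n ≤ x} W(n+h)`, and the rough weight has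
no mass on multiples of small primes, so the only candidate density is the shifted-primes density
`g = g_h := 1_{(d,h)=1, d≠0}/φ(d)` = `Literature.NumberTheory.Sieve.shiftedPrimesDensity h` (tree;
multiplicativity proved there).  Both are bundled below as the tree object
`roughShifted h : Literature.NumberTheory.Sieve.SieveSequence`, so that the inlined `IsBomb` of the crux is
DEFINITIONALLY `density_mult ∧ a_nonneg ∧ IsBombieriSequence ∧ HasDensityConstant` of `roughShifted h`
(the refuters' faithfulness certificate Equiv.lean on stmt-Parity-11307, re-checked here by the kernel:
the composition below is `exact ⟨…⟩` with no rewriting).  The crux then splits into three named pieces: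

* `stub_level`   — (A₂) for `roughShifted h`: level of distribution `x^{1−ε}` for every `ε > 0`, sup over
  `y ≤ x`, for the ONE explicit sequence `W(·+h)` against the model `X_h(y)/φ(d)` on `(d,h) = 1`.
  LOAD-BEARING and OPEN (GEH strength: known only below level `1/2` — Motohashi / Polymath 8b
  Thm 2.7(iii); `4/7` only with well-factorable weights, BFI 1986).  It is the (A₂)-component of the
  route's support item `GEHGivesRoughBombieri` (stmt-Parity-11310): under the route crux `GEH`
  (∀ θ < 1, Polymath 8b Claim 2.6) it follows by a finer-than-dyadic decomposition of `W` into
  convolutions `α ⋆ β` of prime-supported coefficient sequences at scales in `[x^{1/4}, x^{3/4}]`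
  (Siegel–Walfisz for `β` is a theorem), the coprime-mean ↔ `1/φ(d)` comparison (both prime factors
  exceed `m^{1/4}`, so `∑_{m ≤ y, (m,d)>1} W(m) ≪ y^{3/4} log² y · ω(d)`), the classes `(d,h) > 1`
  (mass `O(h⁴ log² h)`), and a grid in `y` for the supremum.
* `stub_density` — (A₁) ∧ (A₅) ∧ `HasDensityConstant 𝔖({0,h})` for `g_h`: pure arithmetic of the
  density.  (A₁): `|g_h(d)| ≤ 1/φ(d) ≪_ε d^{−1+ε}` and `g_h(d) < 1` for `d > 1` (uses `Even h`:
  `g_h(2) = 0`); (A₅): `∑_{(d,h)=1} φ(d)⁻¹ d^{−s} = ζ(s+1)·L(b,s)` with `b` multiplicative, squarefree-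
  supported, `b(p) = 1/(p(p−1))` (`p ∤ h`), `b(p) = −1/p` (`p ∣ h`), absolutely convergent on
  `re s > −1`, `L(b,0) = ∏_{p∤h}(1 + 1/(p(p−1))) ∏_{p∣h}(1 − 1/p) ≠ 0`; Euler product: factor by factor
  `(1 − g_h(p))/(1 − 1/p)` is `p/(p−1)` for `p ∣ h` and `p(p−2)/(p−1)²` for `p ∤ h`, i.e. exactly
  `singularSeriesFactor {0,h} p`, and `tendsto_singularSeriesPartial` is in the tree.  PROVABLE NOW
  (size M); the tree has every piece for `h = 2` (`bombieriA1_shiftedPrimesCounting_two`,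
  `LSeries_shiftedPrimesDensity_two`, `bombieriA5_shiftedPrimesCounting_two`, `reciprocalDensity_mul_G`,
  `singularSeries_pair_holds`) and `shiftedPrimesDensity_prime_eq` for even `h`.
* `stub_size`    — (A₃) ∧ (A₄) for `X_h`: Chebyshev-order facts `x log x ≪ X_h(x) ≪ x log x`
  (`X_h(x) = ½ x log x + O(x)` by Mertens, but only the order is needed) plus the pointwise bound
  `0 ≤ W(m) ≤ 2 log² m` and `#{n ≤ x : d ∣ n} ≤ x/d`: (A₃) with `F(d) = 8 + d/φ(d)`, `c₁ = 1`, `c₂ = 5`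
  exactly as the tree's `bombieriA3_shiftedPrimesCounting`; (A₄): `∫₁ˣ X_h(t) dt/t ≪ x log x = o(X_h log x)`
  and `X_h(√x) ≪ √x log x = o(X_h(x)/log x)`.  PROVABLE NOW (size M–L: Chebyshev's lower bound for
  `θ(y)` summed over `x^{1/4} < q ≤ x^{1/3}`).
* `RoughSemiprimeBombieri_of : RoughSemiprimeBombieri` — the kernel-checked composition (choose
  `X := (roughShifted h).size`, `g := shiftedPrimesDensity h`; definitional repackaging), concluding the
  crux BY NAME; its hypothetical form `(stub sigs) → RoughSemiprimeBombieri` is the `example` after it.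

Calibration (negatives index): `PrimeDeterminantCellsConvMomentLevelOne_refuted` (stmt-Parity-9541) and the
tree's `cmSeq_not_bombieriA2` show that (A₂) with THIS density fails for the odd-restricted convolution
`1_{m odd}(Λ⋆Λ)(m+2)` (bias at every odd prime); the rough weight `W` charges no multiple of a prime
`≤ m^{1/4}`, so the classes `m ≡ h (p)` carry `1/(p−1)` (`p ∤ h`) or `0` (`p ∣ h`) of the mass and
`g_h` is the right model — no stub is an instance of a refuted statement.  Disproof used: none exists
(`ledger crux ls stmt-Parity-11309`: no workfiles, no `Negative/` lemma; nothing to import).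
`sorry` occurs ONLY in the three `stub_*` theorems.
-/

set_option linter.unusedVariables false

namespace Summit.Parity.GeneralizedHardyLittlewood.Cruxes.RoughSemiprimeBombieri.Birth

-- the route file's own `open` context (so that the verbatim copies below elaborate to the crux's terms)
open scoped BigOperators Topology Manifold Classical MeasureTheory ProbabilityTheory Matrix InnerProductSpace ComplexConjugate ContinuousMap
open Filter Set Function TopologicalSpace MeasureTheory

open Literature.NumberTheory.Sieve
open Summit.Parity.GeneralizedHardyLittlewood.Theses.RoughSemiprimeRigidity (RoughSemiprimeBombieri)

/-! ### Vocabulary: the crux's own inlined objects, named (no new objects are posited) -/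

/-- The log-weighted indicator of ROUGH SEMIPRIMES (`η = 1/4`): `W(m) = 2 log q log p` if `m = qp` with
primes `m^{1/4} < q < p`, `W(m) = 0` otherwise — VERBATIM the `let W` of the route decls. [this route] -/
noncomputable def roughWeight : ℕ → ℝ :=
  fun m => ∑ q ∈ m.primeFactors, if (m / q).Prime ∧ q < m / q ∧ m < q ^ 4 then 2 * Real.log q * Real.log ((m / q : ℕ) : ℝ) else 0

/-- `0 ≤ W(m)`: every summand is `0` or `2 log q log p` with `q, p` naturals. [folklore] -/
theorem roughWeight_nonneg (m : ℕ) : 0 ≤ roughWeight m := by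
  unfold roughWeight
  refine Finset.sum_nonneg fun q _ => ?_
  split_ifs
  · exact mul_nonneg (mul_nonneg (by norm_num) (Real.log_natCast_nonneg q)) (Real.log_natCast_nonneg _)
  · exact le_rfl

/-- The shifted rough-semiprime weight `n ↦ W(n+h)` with Bombieri's FORCED data: size `X_h` = its counting
function (spelled exactly as (A₁) demands) and density `g_h = shiftedPrimesDensity h = 1_{(d,h)=1,d≠0}/φ(d)`
(multiplicative, tree lemma). [this route] -/
noncomputable def roughShifted (h : ℕ) : SieveSequence where
  a := fun n : ℕ => roughWeight (n + h)
  a_nonneg := fun n => roughWeight_nonneg (n + h)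
  size := fun x : ℝ => ∑ n ∈ (Finset.Ioc 0 ⌊x⌋₊).filter (1 ∣ ·), roughWeight (n + h)
  density := shiftedPrimesDensity h
  density_mult := isMultiplicative_shiftedPrimesDensity h

/-- Unfolding lemmas for the forced data (definitional). [folklore] -/
theorem roughShifted_a (h n : ℕ) : (roughShifted h).a n = roughWeight (n + h) := rfl

theorem roughShifted_density (h : ℕ) : (roughShifted h).density = shiftedPrimesDensity h := rfl

theorem roughShifted_size (h : ℕ) (x : ℝ) :
    (roughShifted h).size x = ∑ n ∈ (Finset.Ioc 0 ⌊x⌋₊).filter (1 ∣ ·), roughWeight (n + h) := rfl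

/-- The size IS the counting function `A(x; 1)` (Bombieri's (A₁) size clause), definitionally. [folklore] -/
theorem roughShifted_size_eq_congrSum (h : ℕ) (x : ℝ) :
    (roughShifted h).size x = (roughShifted h).congrSum 1 x := rfl

-- BIRTH-VOCABULARY-END (the probes `bc/*_probe.lean` reuse the text above this line verbatim)

/-! ### The three registered stubs -/

/-- **Stub 1 — level of distribution `x^{1−ε}` (Bombieri's (A₂)) for the shifted rough semiprimes.**
For every even `h ≥ 1`, every `ε > 0` and `B > 0`:
`∑_{d < x^{1−ε}} sup_{y ≤ x} |∑_{n ≤ y, d ∣ n} W(n+h) − X_h(y)·1_{(d,h)=1}/φ(d)| ≪ X_h(x) (log x)^{−B}`.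
LOAD-BEARING, OPEN (GEH strength; a theorem only with `1 − ε` replaced by `θ < 1/2`).  Why plausibly true:
it is the instance `α, β` prime-supported at scales `[x^{1/4}, x^{3/4}]` of GEH (Polymath 8b Claim 2.6, the
route crux `GEH` by name) after separating the cutoff `q⁴ > m` and passing from the coprime mean to the
`1/φ(d)` model (error `≪ x^{3/4+o(1)}`); it is exactly the (A₂)-part of the support item
`GEHGivesRoughBombieri` (stmt-Parity-11310).  Why it might fail: level `x^{1−ε}` for EVERY `ε` with the sup
over `y` is beyond every known method (large-sieve barrier at `1/2`; Friedlander–Granville-type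
irregularities kill level `x/(log x)^B` but not `x^{1−ε}`).  Size: open-problem (L given `GEH`).
Leans on: `Literature.NumberTheory.Sieve.GeneralizedElliottHalberstam` (unproved, by name, via the route
crux `GEH`); the tree's Polymath 8b toolkit — `PolymathGEHLevelReduce` (`innerErr_le_iSup_apDiscrepancy_add`,
`coprimeDefect_le`: full mean ↔ coprime mean for rough-supported weights), `PolymathGEHTypeII`,
`PolymathGEHPieces*` / `PolymathGEHWindow*` (finer-than-dyadic pieces), `PolymathGEHPrimePieceLevel`.  Sources: Polymath8b2014 (arXiv:1407.4897)
Claim 2.6, Thm 2.7(iii); BombieriFriedlanderIwaniecActa1986; BombieriRIMS1977 p. 3 (A₂). -/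
theorem stub_level :
    ∀ h : ℕ, 1 ≤ h → Even h → (roughShifted h).BombieriA2 := by
  sorry

/-- **Stub 2 — the density arithmetic: (A₁), (A₅) and the Euler product `= 𝔖({0,h})`** for
`g_h = 1_{(d,h)=1,d≠0}/φ(d)`.  (A₁): `|g_h(d)| ≤ 1/φ(d) ≤ C_ε d^{−1+ε}` (`φ(d) ≫ d/(1 + log d)²`, tree
`totient_inv_le`, `one_add_log_sq_le_rpow`) and `g_h(d) < 1` for `d > 1` (`φ(d) ≥ 2` for `d ≥ 3`; `g_h(2) = 0`
because `h` is even).  (A₅) with `η₁ = 1/2`: `L(g_h, s) = ζ(s+1) L(b_h, s)`, `b_h` multiplicative and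
squarefree-supported with `b_h(p) = 1/(p(p−1))` for `p ∤ h`, `−1/p` for `p ∣ h` (the tree's `G`/`coeff` is the
case `h = 2`), `L(b_h, 0) ≠ 0`.  Density constant: `(1 − g_h(p))/(1 − 1/p) = singularSeriesFactor {0,h} p`
for every prime `p` (`ν_{0,h}(p) = 1` if `p ∣ h`, `2` if `p ∤ h`), so the ordered partial products are
`singularSeriesPartial {0,h}` and converge to `singularSeries {0,h}` (`tendsto_singularSeriesPartial_holds`).
PROVABLE NOW, size M.  Leans on: `shiftedPrimesDensity_apply`, `shiftedPrimesDensity_le_totient_inv`,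
`LSeries_shiftedPrimesDensity_two` / `bombieriA5_data` (pattern), `singularSeriesFactor`,
`tupleResidueCount`.  Sources: BombieriRIMS1977 pp. 3–4 (A₁), (A₅); HalberstamRichert1974 Ch. 1 Ex. 5,
Ch. 10; HardyLittlewood1923 Conj. B. -/
theorem stub_density :
    ∀ h : ℕ, 1 ≤ h → Even h →
      (roughShifted h).BombieriA1 ∧ (roughShifted h).BombieriA5 ∧
        (roughShifted h).HasDensityConstant (singularSeries ({0, (h : ℤ)} : Finset ℤ)) := by
  sorry

/-- **Stub 3 — the size facts: (A₃) and (A₄)** for the counting function `X_h(x) = ∑_{n ≤ x} W(n+h)`.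
Inputs: `0 ≤ W(m) ≤ 2 log² m` (at most the one summand `q = P⁻(m)` is non-zero), hence
`∑_{n ≤ x, d ∣ n} W(n+h) ≤ (x/d) · 2 log²(x+h)`, and the Chebyshev-order bounds
`c x log x ≤ X_h(x) ≤ C x log x` for large `x` (lower: `∑_{x^{1/4} < q ≤ x^{1/3}} log q (θ(x/q) − θ(q)) ≫ x log x`
by `θ(y) ≫ y` and Mertens' `∑ log q / q`; upper: `∑_{q ≤ √x} log q · θ(x/q) ≪ x log x`).  Then (A₃) with
`F(d) = 8 + d/φ(d)`, `c₁ = 1`, `c₂ = 5` as in the tree's `bombieriA3_shiftedPrimesCounting`, and (A₄):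
`∫₁ˣ X_h(t) dt/t ≤ C x log x = O(X_h(x)) = o(X_h(x) log x)`, `X_h(√x) ≤ C √x log x = o(x) = o(X_h(x)/log x)`.
PROVABLE NOW, size M–L (the Chebyshev lower bound for rough semiprimes is the work; compare
`bombieriA4_shiftedPrimesCounting`).  Why it might fail: it does not (orders of magnitude only); the
only trap is the real-variable bookkeeping near `x < 1` (all sums empty, both sides `0`).  Leans on:
Mathlib `Nat.primeCounting` / Chebyshev bounds in the tree (`Literature.NumberTheory.LFunctions.MertensElementary`),
`natCast_div_totient_le`.  Sources: BombieriRIMS1977 p. 3 (A₃), (A₄); FriedlanderIwaniecPisa1978 p. 720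
Example 1. -/
theorem stub_size :
    ∀ h : ℕ, 1 ≤ h → Even h → (roughShifted h).BombieriA3 ∧ (roughShifted h).BombieriA4 := by
  sorry

/-! ### Composition (kernel-checked; `sorry` enters only through the three `stub_*`) -/

/-- Repackaging over the TREE vocabulary: the three stub STATEMENTS give, for every even `h ≥ 1`, that
`roughShifted h` is a Bombieri sequence (`IsBombieriSequence` = size clause ∧ (A₁)–(A₅)) with multiplicative
density, non-negative terms and density constant `𝔖({0,h})` — which is, DEFINITIONALLY, the inlined `IsBomb`
of the crux at the data `X = (roughShifted h).size`, `g = shiftedPrimesDensity h` (refuters' Equiv.lean on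
stmt-Parity-11307; re-checked by the kernel in `RoughSemiprimeBombieri_of`, whose `exact` does no rewriting).
[this line] -/
theorem bombieri_of_parts
    (hL : ∀ h : ℕ, 1 ≤ h → Even h → (roughShifted h).BombieriA2)
    (hD : ∀ h : ℕ, 1 ≤ h → Even h →
      (roughShifted h).BombieriA1 ∧ (roughShifted h).BombieriA5 ∧
        (roughShifted h).HasDensityConstant (singularSeries ({0, (h : ℤ)} : Finset ℤ)))
    (hS : ∀ h : ℕ, 1 ≤ h → Even h → (roughShifted h).BombieriA3 ∧ (roughShifted h).BombieriA4)
    (h : ℕ) (hh : 1 ≤ h) (he : Even h) :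
    (roughShifted h).density.IsMultiplicative ∧ (∀ n : ℕ, 0 ≤ (roughShifted h).a n) ∧
      (roughShifted h).IsBombieriSequence ∧
        (roughShifted h).HasDensityConstant (singularSeries ({0, (h : ℤ)} : Finset ℤ)) := by
  obtain ⟨hA1, hA5, hH⟩ := hD h hh he
  obtain ⟨hA3, hA4⟩ := hS h hh he
  exact ⟨(roughShifted h).density_mult, (roughShifted h).a_nonneg,
    ⟨roughShifted_size_eq_congrSum h, hA1, hL h hh he, hA3, hA4, hA5⟩, hH⟩

/-- **THE SKELETON THEOREM** — the crux
`Summit.Parity.GeneralizedHardyLittlewood.Theses.RoughSemiprimeRigidity.RoughSemiprimeBombieri` BY NAME from the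
three registered stubs: witnesses `X := (roughShifted h).size`, `g := shiftedPrimesDensity h`, and the bundle
`bombieri_of_parts` accepted at the crux's inlined `IsBomb` up to δζ-unfolding (the crux's `let W` is the
verbatim source of `roughWeight`).  No `sorry` of its own; closed exactly when the three stubs are. [this line] -/
theorem RoughSemiprimeBombieri_of : RoughSemiprimeBombieri := by
  intro h hh he
  exact ⟨(roughShifted h).size, shiftedPrimesDensity h,
    bombieri_of_parts stub_level stub_density stub_size h hh he⟩

/-- The hypothetical form `(stub₁-sig) → (stub₂-sig) → (stub₃-sig) → RoughSemiprimeBombieri` — pure logic in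
the stub STATEMENTS, no stub used (an `example`, so that `RoughSemiprimeBombieri_of` stays the unique
declaration of this file concluding the crux). -/
example :
    (∀ h : ℕ, 1 ≤ h → Even h → (roughShifted h).BombieriA2) →
    (∀ h : ℕ, 1 ≤ h → Even h →
      (roughShifted h).BombieriA1 ∧ (roughShifted h).BombieriA5 ∧
        (roughShifted h).HasDensityConstant (singularSeries ({0, (h : ℤ)} : Finset ℤ))) →
    (∀ h : ℕ, 1 ≤ h → Even h → (roughShifted h).BombieriA3 ∧ (roughShifted h).BombieriA4) →
    RoughSemiprimeBombieri := by
  intro hL hD hS h hh he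
  exact ⟨(roughShifted h).size, shiftedPrimesDensity h, bombieri_of_parts hL hD hS h hh he⟩

-- audit: the conclusion is the route decl itself
#check (RoughSemiprimeBombieri_of :
  Summit.Parity.GeneralizedHardyLittlewood.Theses.RoughSemiprimeRigidity.RoughSemiprimeBombieri)

end Summit.Parity.GeneralizedHardyLittlewood.Cruxes.RoughSemiprimeBombieri.Birth
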